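import Literature.Probability.LatticeModels.RandomClusterRimWiringOutsideCount
import Literature.Probability.LatticeModels.RandomClusterRimWiringEvents
import HarnessLib

/-!
# Markov property at an explored set, ambient wiring OUTSIDE the explored set (proved)

Topic `Literature/Probability/LatticeModels` (trunk `StatMech`, family `crit-ising`). Companion of
`RandomClusterRimWiringWired.lean` / `RandomClusterRimWiringEvents.lean` for the exploration FROM
INSIDE of Basu–Sapozhnikov (2017, §2) and Kesten (1986, proof of Thm. 3): `S` is the explored vertex
set, `T` the set of edges of `G` TOUCHING `S` (at least one endpoint in `S`), `R` the rim (vertices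
outside `S` attached to `S` by open edges), and the context event `F` is determined by the
configuration on `T`, forces every open edge of `T` leaving `S` to end in `R` (rim) and joins any two
rim vertices by an open path inside `T` (wire). The ambient wired set `B` of `φ = φ^B_{G,p,q}` lies
in the UNEXPLORED side (`B ∩ S = ∅`), so that the law of the configuration off `T` given `F` is a
TWO-block object (rim block `R`, ambient block `B`). From the factorisation of
`RandomClusterRimWiringOutsideCount.lean` we deduce:

* `rcMeasure_real_condIndep_of_rim_wired_outside` (M3) — conditional independence given `F` of the
  configurations on and off `T`: `φ(F ∩ A ∩ C) φ(F) = φ(F ∩ A) φ(F ∩ C)`;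
* `rcMeasure_real_inside_cond_eq_of_rim_wired` (M3') — the inside conditional law `φ(F ∩ A)/φ(F)`
  does not depend on the graph and the wiring away from `T`;
* `rcMeasure_real_outside_cond_two_block_bounds` (M4) — for `q ≥ 1` the outside conditional law is
  within a factor `q^{±1}` of the one-block measure `φ^{R ∪ B}_{⟨E ∖ T⟩}`.

Everything is proved; no definitions, no named facts.

## References

* G. Grimmett, *The Random-Cluster Model*, Springer (2006): §4.2, Lemma (4.13).
* D. Basu, A. Sapozhnikov, Kesten's incipient infinite cluster and quasi-multiplicativity of
  crossing probabilities, *Electron. Commun. Probab.* 22 (2017), §2 (exploration from inside).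
* H. Kesten, The incipient infinite cluster in two-dimensional percolation, *Probab. Theory Related
  Fields* 73 (1986) 369–394: proof of Thm. 3.
-/

noncomputable section

open MeasureTheory Finset SimpleGraph
open Literature.Probability.Percolation (BondConfig)

namespace Literature.Probability.LatticeModels

/-! ### Arithmetic -/

section Arith

/-- The arithmetic of the two-block bounds: if `Z φ(F ∩ C) c = P · Q_C`, `Z φ(F) c = P · Q_1` with
two-block sums `Q` squeezed between the one-block quantities, `Z_M ν(C) ≤ Q_C ≤ q Z_M ν(C)` and
`Z_M ≤ Q_1 ≤ q Z_M`, then `φ(F ∩ C) ≤ q φ(F) ν(C)` and `φ(F) ν(C) ≤ q φ(F ∩ C)`. [folklore] -/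
theorem two_block_bounds_arith {q Z ZM c μFC μF νC PU QC QU : ℝ}
    (k1 : Z * μFC * c = PU * QC) (k2 : Z * μF * c = PU * QU)
    (bC1 : ZM * νC ≤ QC) (bC2 : QC ≤ q * (ZM * νC)) (bU1 : ZM ≤ QU) (bU2 : QU ≤ q * ZM)
    (hq : 0 ≤ q) (hZ : 0 < Z) (hZM : 0 < ZM) (hc : 0 < c) (hμF : 0 ≤ μF) (hνC : 0 ≤ νC) :
    μFC ≤ q * μF * νC ∧ μF * νC ≤ q * μFC := by
  have hQU : 0 < QU := hZM.trans_le bU1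
  have hPU : 0 ≤ PU := by
    refine nonneg_of_mul_nonneg_left ?_ hQU
    rw [← k2]
    positivity
  have hpos : 0 < Z * c * ZM := by positivity
  constructor
  · refine le_of_mul_le_mul_left ?_ hpos
    calc Z * c * ZM * μFC = ZM * (Z * μFC * c) := by ring
      _ = ZM * (PU * QC) := by rw [k1]
      _ ≤ ZM * (PU * (q * (ZM * νC))) :=
          mul_le_mul_of_nonneg_left (mul_le_mul_of_nonneg_left bC2 hPU) hZM.le
      _ = (q * PU * (νC * ZM)) * ZM := by ring
      _ ≤ (q * PU * (νC * ZM)) * QU :=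
          mul_le_mul_of_nonneg_left bU1 (mul_nonneg (mul_nonneg hq hPU) (mul_nonneg hνC hZM.le))
      _ = q * νC * ZM * (PU * QU) := by ring
      _ = q * νC * ZM * (Z * μF * c) := by rw [k2]
      _ = Z * c * ZM * (q * μF * νC) := by ring
  · refine le_of_mul_le_mul_left ?_ hpos
    calc Z * c * ZM * (μF * νC) = (Z * μF * c) * (ZM * νC) := by ring
      _ = (PU * QU) * (ZM * νC) := by rw [k2]
      _ ≤ (PU * (q * ZM)) * (ZM * νC) :=
          mul_le_mul_of_nonneg_right (mul_le_mul_of_nonneg_left bU2 hPU) (mul_nonneg hZM.le hνC)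
      _ = (q * PU * ZM) * (ZM * νC) := by ring
      _ ≤ (q * PU * ZM) * QC :=
          mul_le_mul_of_nonneg_left bC1 (mul_nonneg (mul_nonneg hq hPU) hZM.le)
      _ = q * ZM * (PU * QC) := by ring
      _ = q * ZM * (Z * μFC * c) := by rw [k1]
      _ = Z * c * ZM * (q * μFC) := by ring

end Arith

/-! ### The three Markov-type statements -/

section Main

/-- **(M3) Conditional independence of inside and outside given an explored-set event, ambient
wired set OUTSIDE the explored set** (Grimmett 2006, Lemma (4.13); Basu–Sapozhnikov 2017, §2;
Kesten 1986, proof of Thm. 3). Let `T` be the set of edges of `G` touching `S`, `R, B ⊆ Sᶜ`, and `F`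
an event determined on `T` such that on `F` every open edge of `T` leaving `S` ends in `R` and any
two vertices of `R` are joined by an open path in `T`. Then for every `A` determined on `T` and every
`C` determined on `E(G) ∖ T`, `φ(F ∩ A ∩ C) · φ(F) = φ(F ∩ A) · φ(F ∩ C)` for `φ = φ^B_{G,p,q}`
(`0 ≤ p ≤ 1`, `q > 0`). [cite: Grimmett2006, Lemma (4.13)] -/
theorem rcMeasure_real_condIndep_of_rim_wired_outside {V : Type*} [Fintype V] [DecidableEq V]
    (G : SimpleGraph V) [DecidableRel G.Adj] {p q : ℝ} (hp : p ∈ Set.Icc (0 : ℝ) 1) (hq : 0 < q)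
    (B S R : Set V) (T : Finset (Sym2 V))
    (hT : ∀ e, e ∈ T ↔ e ∈ G.edgeFinset ∧ ∃ v ∈ S, v ∈ e)
    (_hRS : ∀ r ∈ R, r ∉ S) (hBS : ∀ b ∈ B, b ∉ S)
    (F : Set (BondConfig V))
    (hFdet : ∀ ω₁ ω₂ : BondConfig V, ω₁ ∩ ↑T = ω₂ ∩ ↑T → (ω₁ ∈ F ↔ ω₂ ∈ F))
    (hFrim : ∀ ω ∈ F, ∀ e ∈ ω, e ∈ T → ∀ x ∈ e, x ∉ S → x ∈ R)
    (hFwire : ∀ ω ∈ F, ∀ x ∈ R, ∀ y ∈ R, (fromEdgeSet (ω ∩ ↑T)).Reachable x y)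
    (A C : Set (BondConfig V))
    (hA : ∀ ω₁ ω₂ : BondConfig V, ω₁ ∩ ↑T = ω₂ ∩ ↑T → (ω₁ ∈ A ↔ ω₂ ∈ A))
    (hC : ∀ ω₁ ω₂ : BondConfig V,
      ω₁ ∩ (↑(G.edgeFinset \ T)) = ω₂ ∩ (↑(G.edgeFinset \ T)) → (ω₁ ∈ C ↔ ω₂ ∈ C)) :
    (rcMeasure G p q B).real (F ∩ A ∩ C) * (rcMeasure G p q B).real F =
      (rcMeasure G p q B).real (F ∩ A) * (rcMeasure G p q B).real (F ∩ C) := by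
  classical
  have hZ := rcPartitionFunction_pos G hp hq B
  have hqR : 0 < q ^ clusterCount (∅ : BondConfig V) R := pow_pos hq _
  have hU : ∀ ω₁ ω₂ : BondConfig V, ω₁ ∩ ↑T = ω₂ ∩ ↑T →
      (ω₁ ∈ (Set.univ : Set (BondConfig V)) ↔ ω₂ ∈ (Set.univ : Set (BondConfig V))) :=
    fun _ _ _ ↦ by simp only [Set.mem_univ]
  have hU' : ∀ ω₁ ω₂ : BondConfig V, ω₁ ∩ (↑(G.edgeFinset \ T)) = ω₂ ∩ (↑(G.edgeFinset \ T)) →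
      (ω₁ ∈ (Set.univ : Set (BondConfig V)) ↔ ω₂ ∈ (Set.univ : Set (BondConfig V))) :=
    fun _ _ _ ↦ by simp only [Set.mem_univ]
  have k1 := rcPartitionFunction_mul_real_inter_mul_pow_eq_of_rim_wired_outside G hp hq hT hBS hFdet
    hFrim hFwire A C hA hC
  have k2 := rcPartitionFunction_mul_real_inter_mul_pow_eq_of_rim_wired_outside G hp hq hT hBS hFdet
    hFrim hFwire Set.univ Set.univ hU hU'
  have k3 := rcPartitionFunction_mul_real_inter_mul_pow_eq_of_rim_wired_outside G hp hq hT hBS hFdet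
    hFrim hFwire A Set.univ hA hU'
  have k4 := rcPartitionFunction_mul_real_inter_mul_pow_eq_of_rim_wired_outside G hp hq hT hBS hFdet
    hFrim hFwire Set.univ C hU hC
  have e2 : F ∩ Set.univ ∩ Set.univ = F := by rw [Set.inter_univ, Set.inter_univ]
  have e3 : F ∩ A ∩ Set.univ = F ∩ A := by rw [Set.inter_univ]
  have e4 : F ∩ Set.univ ∩ C = F ∩ C := by rw [Set.inter_univ]
  rw [e2] at k2
  rw [e3] at k3
  rw [e4] at k4
  have e1 : (rcPartitionFunction G p q B * (rcMeasure G p q B).real (F ∩ A ∩ C) *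
        q ^ clusterCount (∅ : BondConfig V) R) *
      (rcPartitionFunction G p q B * (rcMeasure G p q B).real F *
        q ^ clusterCount (∅ : BondConfig V) R) =
      (rcPartitionFunction G p q B * (rcMeasure G p q B).real (F ∩ A) *
        q ^ clusterCount (∅ : BondConfig V) R) *
      (rcPartitionFunction G p q B * (rcMeasure G p q B).real (F ∩ C) *
        q ^ clusterCount (∅ : BondConfig V) R) := by
    rw [k1, k2, k3, k4]; ring
  have hZq : rcPartitionFunction G p q B * q ^ clusterCount (∅ : BondConfig V) R ≠ 0 :=
    (mul_pos hZ hqR).ne'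
  apply mul_left_cancel₀ (mul_ne_zero hZq hZq)
  linear_combination e1

/-- **(M3') The inside conditional law does not depend on the graph and the wiring away from the
touching edges** (Grimmett 2006, Lemma (4.13); Basu–Sapozhnikov 2017, §2). For two graphs `G, G'` on
`V` with the same set `T` of edges touching `S`, wired sets `B, B' ⊆ Sᶜ`, a context event `F` as in
`rcMeasure_real_condIndep_of_rim_wired_outside` and `A` determined on `T`:
`φ^B_G(F ∩ A) · φ^{B'}_{G'}(F) = φ^{B'}_{G'}(F ∩ A) · φ^B_G(F)`. [cite: Grimmett2006, Lemma (4.13)] -/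
theorem rcMeasure_real_inside_cond_eq_of_rim_wired {V : Type*} [Fintype V] [DecidableEq V]
    (G G' : SimpleGraph V) [DecidableRel G.Adj] [DecidableRel G'.Adj]
    {p q : ℝ} (hp : p ∈ Set.Icc (0 : ℝ) 1) (hq : 0 < q)
    (B B' S R : Set V) (T : Finset (Sym2 V))
    (hT : ∀ e, e ∈ T ↔ e ∈ G.edgeFinset ∧ ∃ v ∈ S, v ∈ e)
    (hT' : ∀ e, e ∈ T ↔ e ∈ G'.edgeFinset ∧ ∃ v ∈ S, v ∈ e)
    (_hRS : ∀ r ∈ R, r ∉ S) (hBS : ∀ b ∈ B, b ∉ S) (hBS' : ∀ b ∈ B', b ∉ S)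
    (F : Set (BondConfig V))
    (hFdet : ∀ ω₁ ω₂ : BondConfig V, ω₁ ∩ ↑T = ω₂ ∩ ↑T → (ω₁ ∈ F ↔ ω₂ ∈ F))
    (hFrim : ∀ ω ∈ F, ∀ e ∈ ω, e ∈ T → ∀ x ∈ e, x ∉ S → x ∈ R)
    (hFwire : ∀ ω ∈ F, ∀ x ∈ R, ∀ y ∈ R, (fromEdgeSet (ω ∩ ↑T)).Reachable x y)
    (A : Set (BondConfig V))
    (hA : ∀ ω₁ ω₂ : BondConfig V, ω₁ ∩ ↑T = ω₂ ∩ ↑T → (ω₁ ∈ A ↔ ω₂ ∈ A)) :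
    (rcMeasure G p q B).real (F ∩ A) * (rcMeasure G' p q B').real F =
      (rcMeasure G' p q B').real (F ∩ A) * (rcMeasure G p q B).real F := by
  classical
  have hZ := rcPartitionFunction_pos G hp hq B
  have hZ' := rcPartitionFunction_pos G' hp hq B'
  have hqR : 0 < q ^ clusterCount (∅ : BondConfig V) R := pow_pos hq _
  have hU : ∀ ω₁ ω₂ : BondConfig V, ω₁ ∩ ↑T = ω₂ ∩ ↑T →
      (ω₁ ∈ (Set.univ : Set (BondConfig V)) ↔ ω₂ ∈ (Set.univ : Set (BondConfig V))) :=
    fun _ _ _ ↦ by simp only [Set.mem_univ]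
  have hUG : ∀ ω₁ ω₂ : BondConfig V, ω₁ ∩ (↑(G.edgeFinset \ T)) = ω₂ ∩ (↑(G.edgeFinset \ T)) →
      (ω₁ ∈ (Set.univ : Set (BondConfig V)) ↔ ω₂ ∈ (Set.univ : Set (BondConfig V))) :=
    fun _ _ _ ↦ by simp only [Set.mem_univ]
  have hUG' : ∀ ω₁ ω₂ : BondConfig V, ω₁ ∩ (↑(G'.edgeFinset \ T)) = ω₂ ∩ (↑(G'.edgeFinset \ T)) →
      (ω₁ ∈ (Set.univ : Set (BondConfig V)) ↔ ω₂ ∈ (Set.univ : Set (BondConfig V))) :=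
    fun _ _ _ ↦ by simp only [Set.mem_univ]
  have k1 := rcPartitionFunction_mul_real_inter_mul_pow_eq_of_rim_wired_outside G hp hq hT hBS hFdet
    hFrim hFwire A Set.univ hA hUG
  have k2 := rcPartitionFunction_mul_real_inter_mul_pow_eq_of_rim_wired_outside G hp hq hT hBS hFdet
    hFrim hFwire Set.univ Set.univ hU hUG
  have k3 := rcPartitionFunction_mul_real_inter_mul_pow_eq_of_rim_wired_outside G' hp hq hT' hBS'
    hFdet hFrim hFwire A Set.univ hA hUG'
  have k4 := rcPartitionFunction_mul_real_inter_mul_pow_eq_of_rim_wired_outside G' hp hq hT' hBS'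
    hFdet hFrim hFwire Set.univ Set.univ hU hUG'
  have e2 : F ∩ Set.univ ∩ Set.univ = F := by rw [Set.inter_univ, Set.inter_univ]
  have e3 : F ∩ A ∩ Set.univ = F ∩ A := by rw [Set.inter_univ]
  rw [e3] at k1 k3
  rw [e2] at k2 k4
  have e1 : (rcPartitionFunction G p q B * (rcMeasure G p q B).real (F ∩ A) *
        q ^ clusterCount (∅ : BondConfig V) R) *
      (rcPartitionFunction G' p q B' * (rcMeasure G' p q B').real F *
        q ^ clusterCount (∅ : BondConfig V) R) =
      (rcPartitionFunction G' p q B' * (rcMeasure G' p q B').real (F ∩ A) *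
        q ^ clusterCount (∅ : BondConfig V) R) *
      (rcPartitionFunction G p q B * (rcMeasure G p q B).real F *
        q ^ clusterCount (∅ : BondConfig V) R) := by
    rw [k1, k2, k3, k4]; ring
  have hZq : rcPartitionFunction G p q B * q ^ clusterCount (∅ : BondConfig V) R ≠ 0 :=
    (mul_pos hZ hqR).ne'
  have hZq' : rcPartitionFunction G' p q B' * q ^ clusterCount (∅ : BondConfig V) R ≠ 0 :=
    (mul_pos hZ' hqR).ne'
  apply mul_left_cancel₀ (mul_ne_zero hZq hZq')
  linear_combination e1

/-- **(M4) The outside conditional law is within `q^{±1}` of the one-block measure with the rim and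
the ambient wired set wired together** (Grimmett 2006, Lemma (4.13); Basu–Sapozhnikov 2017, §2). In
the setting of `rcMeasure_real_condIndep_of_rim_wired_outside` with `q ≥ 1`, for every event `C`
determined on `E(G) ∖ T` and `ν = φ^{R ∪ B}_{⟨E(G) ∖ T⟩,p,q}`:
`φ(F ∩ C) ≤ q · φ(F) · ν(C)` and `φ(F) · ν(C) ≤ q · φ(F ∩ C)` (the conditional law of the outside
given `F` wires `R` and `B` as two blocks; merging them costs at most one factor `q`).
[cite: Grimmett2006, Lemma (4.13)] -/
theorem rcMeasure_real_outside_cond_two_block_bounds {V : Type*} [Fintype V] [DecidableEq V]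
    (G : SimpleGraph V) [DecidableRel G.Adj] {p q : ℝ} (hp : p ∈ Set.Icc (0 : ℝ) 1) (hq : 1 ≤ q)
    (B S R : Set V) (T : Finset (Sym2 V))
    (hT : ∀ e, e ∈ T ↔ e ∈ G.edgeFinset ∧ ∃ v ∈ S, v ∈ e)
    (_hRS : ∀ r ∈ R, r ∉ S) (hBS : ∀ b ∈ B, b ∉ S)
    (F : Set (BondConfig V))
    (hFdet : ∀ ω₁ ω₂ : BondConfig V, ω₁ ∩ ↑T = ω₂ ∩ ↑T → (ω₁ ∈ F ↔ ω₂ ∈ F))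
    (hFrim : ∀ ω ∈ F, ∀ e ∈ ω, e ∈ T → ∀ x ∈ e, x ∉ S → x ∈ R)
    (hFwire : ∀ ω ∈ F, ∀ x ∈ R, ∀ y ∈ R, (fromEdgeSet (ω ∩ ↑T)).Reachable x y)
    (C : Set (BondConfig V))
    (hC : ∀ ω₁ ω₂ : BondConfig V,
      ω₁ ∩ (↑(G.edgeFinset \ T)) = ω₂ ∩ (↑(G.edgeFinset \ T)) → (ω₁ ∈ C ↔ ω₂ ∈ C)) :
    (rcMeasure G p q B).real (F ∩ C) ≤
        q * (rcMeasure G p q B).real F *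
          (rcMeasure (fromEdgeSet (↑(G.edgeFinset \ T) : Set (Sym2 V))) p q (R ∪ B)).real C ∧
      (rcMeasure G p q B).real F *
          (rcMeasure (fromEdgeSet (↑(G.edgeFinset \ T) : Set (Sym2 V))) p q (R ∪ B)).real C ≤
        q * (rcMeasure G p q B).real (F ∩ C) := by
  classical
  have hq0 : 0 < q := one_pos.trans_le hq
  have hZ := rcPartitionFunction_pos G hp hq0 B
  have hZM := rcPartitionFunction_pos (fromEdgeSet (↑(G.edgeFinset \ T) : Set (Sym2 V))) hp hq0 (R ∪ B)
  have hqR : 0 < q ^ clusterCount (∅ : BondConfig V) R := pow_pos hq0 _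
  have hEU : ∀ i : Fintype (fromEdgeSet (↑(G.edgeFinset \ T) : Set (Sym2 V))).edgeSet,
      @SimpleGraph.edgeFinset V (fromEdgeSet (↑(G.edgeFinset \ T) : Set (Sym2 V))) i =
        G.edgeFinset \ T := fun i ↦
    @edgeFinset_fromEdgeSet_of_subset V _ G _ (G.edgeFinset \ T) sdiff_subset i
  -- the one-block sums
  have hWC : rcPartitionFunction (fromEdgeSet (↑(G.edgeFinset \ T) : Set (Sym2 V))) p q (R ∪ B) *
      (rcMeasure (fromEdgeSet (↑(G.edgeFinset \ T) : Set (Sym2 V))) p q (R ∪ B)).real C =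
      ∑ η ∈ (G.edgeFinset \ T).powerset, if (↑η : BondConfig V) ∈ C then
        rcWeight (fromEdgeSet (↑(G.edgeFinset \ T) : Set (Sym2 V))) p q (R ∪ B) η else 0 := by
    rw [rcMeasure_real_apply _ hp hq0 (R ∪ B) C, Finset.mul_sum, hEU]
    refine Finset.sum_congr rfl fun η _ ↦ ?_
    split_ifs
    · field_simp
    · simp
  have hWU : rcPartitionFunction (fromEdgeSet (↑(G.edgeFinset \ T) : Set (Sym2 V))) p q (R ∪ B) =
      ∑ η ∈ (G.edgeFinset \ T).powerset, if (↑η : BondConfig V) ∈ (Set.univ : Set (BondConfig V)) then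
        rcWeight (fromEdgeSet (↑(G.edgeFinset \ T) : Set (Sym2 V))) p q (R ∪ B) η else 0 := by
    rw [rcPartitionFunction, hEU]
    refine Finset.sum_congr rfl fun η _ ↦ ?_
    rw [if_pos (Set.mem_univ _)]
  -- the two-sided bounds of the two-block sums
  obtain ⟨bC1, bC2⟩ := sum_rcWeight_fromEdgeSet_le_two_blocks G hp hq R B
    (sdiff_subset : G.edgeFinset \ T ⊆ G.edgeFinset) C
  obtain ⟨bU1, bU2⟩ := sum_rcWeight_fromEdgeSet_le_two_blocks G hp hq R B
    (sdiff_subset : G.edgeFinset \ T ⊆ G.edgeFinset) (Set.univ : Set (BondConfig V))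
  rw [← hWC] at bC1 bC2
  rw [← hWU] at bU1 bU2
  -- the factorised ambient sums
  have hU : ∀ ω₁ ω₂ : BondConfig V, ω₁ ∩ ↑T = ω₂ ∩ ↑T →
      (ω₁ ∈ (Set.univ : Set (BondConfig V)) ↔ ω₂ ∈ (Set.univ : Set (BondConfig V))) :=
    fun _ _ _ ↦ by simp only [Set.mem_univ]
  have hU' : ∀ ω₁ ω₂ : BondConfig V, ω₁ ∩ (↑(G.edgeFinset \ T)) = ω₂ ∩ (↑(G.edgeFinset \ T)) →
      (ω₁ ∈ (Set.univ : Set (BondConfig V)) ↔ ω₂ ∈ (Set.univ : Set (BondConfig V))) :=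
    fun _ _ _ ↦ by simp only [Set.mem_univ]
  have k1 := rcPartitionFunction_mul_real_inter_mul_pow_eq_of_rim_wired_outside G hp hq0 hT hBS hFdet
    hFrim hFwire Set.univ C hU hC
  have k2 := rcPartitionFunction_mul_real_inter_mul_pow_eq_of_rim_wired_outside G hp hq0 hT hBS hFdet
    hFrim hFwire Set.univ Set.univ hU hU'
  have e4 : F ∩ Set.univ ∩ C = F ∩ C := by rw [Set.inter_univ]
  have e2 : F ∩ Set.univ ∩ Set.univ = F := by rw [Set.inter_univ, Set.inter_univ]
  rw [e4] at k1
  rw [e2] at k2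
  exact two_block_bounds_arith k1 k2 bC1 bC2 bU1 bU2 hq0.le hZ hZM hqR measureReal_nonneg
    measureReal_nonneg

end Main

end Literature.Probability.LatticeModels

end
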